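import Summits.BirchSwinnertonDyer.BirchSwinnertonDyer.Theorems.BiquadraticEisensteinDescentHeegnerTwistCouplingInSupplyHeegnerBoxDensity
import Summits.BirchSwinnertonDyer.BirchSwinnertonDyer.Theorems.BiquadraticEisensteinDescentHeegnerTwistCouplingInSupplyNonNullBasics
import Literature.NumberTheory.EllipticCurves.BSDSelmerSmithDensityProofs
import HarnessLib

/-!
# C⁺(N,p) ⟺ positive UPPER relative density of `p ∤ h` in the Heegner box; monotonicity in the level

Continuation of `…HeegnerTwistCouplingInSupplyHeegnerBoxDensity.lean` (crux `HeegnerTwistCouplingInSupply`,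
stmt-BirchSwinnertonDyer-21381, line `size_tail` v4, research stub `stub_nonNullIndivisibleHeegner`; its
conclusion at `(N, p)` is called C⁺(N,p) below). THEOREMS ONLY; nothing is closed; BSD is not proved by
any of this. That file proved C⁺(N,p) ⟸ an EVENTUAL (lower-density) bound and C⁺(N,p) ⟹ a FREQUENT
(upper-density) bound. Here the currency is made exact:

* `not_twistDensity_zero_iff_exists_pos_frequently_le` — for any predicate `P`: the squarefree `d` with
  `P d` are not `twistDensity`-null iff for some `c > 0`, frequently in `X`, they are at least the
  proportion `c` of all squarefree `|d| ≤ X` (the ratio is in `[0, 1]`).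
* ★ `nonNull_iff_frequently_le_heegnerBox` — **C⁺(N,p) ⟺ for some `c > 0`, frequently in `X`, at least the
  proportion `c` of the Heegner box `{d squarefree : |d| ≤ X, ∃ K imaginary quadratic, d_K = d, |d| > 4,
  Heegner for N}` carries a field with `p ∤ h`** (`N ≠ 0`; the box has positive lower proportion by
  `exists_pos_eventually_le_heegnerBox_ratio`). So the stub is, level by level, the statement «`p ∤ h_K` has
  positive upper relative density among the imaginary quadratic fields of the Heegner box of level `N`» —
  class numbers of imaginary quadratic fields only; for `p ≥ 5` not in print (Kohnen–Ono 1999, Beckwith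
  2017: `≫ √X / log X` members, with local conditions; Davenport–Heilbronn / Bhargava–Varma at `p = 3`).
* `nonNull_one_of_nonNull` — with the level monotonicity C⁺(N,p) ⟹ C⁺(M,p) for `M ∣ N` of the tree
  (`…NonNullBasics.nonNull_of_dvd`, w1 g17): every instance of the stub implies its level-`1` instance — the
  squarefree `d` that are discriminants of imaginary quadratic fields with `|d| > 4` and `p ∤ h` are not null,
  the local-condition-free Cohen–Lenstra-type non-vanishing density, itself open for `p ≥ 5`;
  `nonNull_one_of_stub` — the same from the registered stub signature.
-/

set_option linter.dupNamespace false -- `Summit.BirchSwinnertonDyer.BirchSwinnertonDyer.Theorems.…` (summit = sub, D-0017)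
set_option autoImplicit false

noncomputable section

open scoped Classical
open Finset Filter Topology
open Literature.NumberTheory.EllipticCurves
open Summit.BirchSwinnertonDyer.BirchSwinnertonDyer.Theorems.InertBadSignedBranchesInertBadAtThreeNonNullOddHeegner
  (natCard_squarefree_abs_le_pos)
open Summit.BirchSwinnertonDyer.BirchSwinnertonDyer.Theorems.BiquadraticEisensteinDescentHeegnerTwistCouplingInSupplyHeegnerBoxDensity
open Summit.BirchSwinnertonDyer.BirchSwinnertonDyer.Theorems.BiquadraticEisensteinDescentHeegnerTwistCouplingInSupplyNonNullBasics
  (nonNull_of_dvd)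

namespace Summit.BirchSwinnertonDyer.BirchSwinnertonDyer.Theorems.BiquadraticEisensteinDescentHeegnerTwistCouplingInSupplyHeegnerBoxDensityIff

/-! ### Non-nullity ⟺ a positive proportion frequently -/

/-- **A positive proportion frequently gives non-nullity**: if for some `c > 0`, frequently in `X`, the
squarefree `d` with `P d` are at least the proportion `c` of all squarefree `|d| ≤ X`, then they are not a
`twistDensity`-null set. [folklore] -/
theorem not_twistDensity_zero_of_frequently_le {P : ℤ → Prop} {c : ℝ} (hc : 0 < c)
    (hfr : ∃ᶠ X : ℕ in atTop,
      c * (Nat.card {d : ℤ | Squarefree d ∧ |d| ≤ (X : ℤ)} : ℝ) ≤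
        (Nat.card {d : ℤ | Squarefree d ∧ |d| ≤ (X : ℤ) ∧ P d} : ℝ)) :
    ¬ twistDensity P 0 := by
  intro hT
  have hev : ∀ᶠ X : ℕ in atTop, (Nat.card {d : ℤ | Squarefree d ∧ |d| ≤ (X : ℤ) ∧ P d} : ℝ) /
      Nat.card {d : ℤ | Squarefree d ∧ |d| ≤ (X : ℤ)} < c :=
    (tendsto_order.1 hT).2 _ hc
  refine (hfr.and_eventually (hev.and (eventually_ge_atTop 1))).mono ?_ |>.exists.elim fun X hX => hX
  rintro X ⟨h1, h2, hX1⟩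
  have hDenpos : (0 : ℝ) < Nat.card {d : ℤ | Squarefree d ∧ |d| ≤ (X : ℤ)} := by
    exact_mod_cast natCard_squarefree_abs_le_pos hX1
  rw [div_lt_iff₀ hDenpos] at h2
  linarith

/-- **Non-nullity ⟺ a positive proportion frequently.** For any predicate `P`: the squarefree `d` with
`P d` are not a `twistDensity`-null set iff for some `c > 0`, frequently in `X`, they make up at least
the proportion `c` of all squarefree `|d| ≤ X`. [folklore] -/
theorem not_twistDensity_zero_iff_exists_pos_frequently_le {P : ℤ → Prop} :
    ¬ twistDensity P 0 ↔ ∃ c : ℝ, 0 < c ∧ ∃ᶠ X : ℕ in atTop,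
      c * (Nat.card {d : ℤ | Squarefree d ∧ |d| ≤ (X : ℤ)} : ℝ) ≤
        (Nat.card {d : ℤ | Squarefree d ∧ |d| ≤ (X : ℤ) ∧ P d} : ℝ) :=
  ⟨exists_pos_frequently_le_of_not_twistDensity_zero,
    fun ⟨_, hc, hfr⟩ => not_twistDensity_zero_of_frequently_le hc hfr⟩

/-! ### C⁺(N,p) ⟺ positive upper relative density of `p ∤ h` inside the Heegner box -/

/-- ★ **C⁺(N,p) ⟺ a positive proportion of the Heegner box, frequently** (`N ≠ 0`, any `p`): the Heegner
discriminants of level `N` with `p ∤ h` are not `twistDensity`-null (the conclusion of the registered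
stub `stub_nonNullIndivisibleHeegner` at `(N, p)`) iff for some `c > 0`, frequently in `X`, at least
the proportion `c` of the Heegner box `{d squarefree : |d| ≤ X, ∃ K imaginary quadratic, d_K = d,
|d| > 4, every prime factor of N split in K}` carries a field with `p ∤ h` — a statement about class
numbers of imaginary quadratic fields alone (the box has positive lower proportion among all squarefree
`d`, `exists_pos_eventually_le_heegnerBox_ratio`). For `p ≥ 5` the right-hand side is not in print.
[folklore] -/
theorem nonNull_iff_frequently_le_heegnerBox {N : ℕ} (hN : N ≠ 0) (p : ℕ) :
    ¬ twistDensity (fun d : ℤ ↦ ∃ (K : Type) (_ : Field K) (_ : NumberField K),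
        IsImaginaryQuadratic K ∧ NumberField.discr K = d ∧ 4 < d.natAbs ∧
        SatisfiesHeegnerHypothesis N K ∧ ¬ p ∣ NumberField.classNumber K) 0 ↔
      ∃ c : ℝ, 0 < c ∧ ∃ᶠ X : ℕ in atTop,
        c * (Nat.card {d : ℤ | Squarefree d ∧ |d| ≤ (X : ℤ) ∧
          ∃ (K : Type) (_ : Field K) (_ : NumberField K), IsImaginaryQuadratic K ∧
            NumberField.discr K = d ∧ 4 < d.natAbs ∧ SatisfiesHeegnerHypothesis N K} : ℝ) ≤
          (Nat.card {d : ℤ | Squarefree d ∧ |d| ≤ (X : ℤ) ∧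
            ∃ (K : Type) (_ : Field K) (_ : NumberField K), IsImaginaryQuadratic K ∧
              NumberField.discr K = d ∧ 4 < d.natAbs ∧ SatisfiesHeegnerHypothesis N K ∧
              ¬ p ∣ NumberField.classNumber K} : ℝ) := by
  refine ⟨exists_pos_frequently_le_heegnerBox_of_not_twistDensity_zero, fun ⟨c, hc, hfr⟩ => ?_⟩
  obtain ⟨c₁, hc₁, hev⟩ := exists_pos_eventually_le_heegnerBox_ratio hN
  refine not_twistDensity_zero_of_frequently_le (mul_pos hc hc₁) ?_
  refine (hfr.and_eventually (hev.and (eventually_ge_atTop 1))).mono ?_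
  rintro X ⟨h1, h2, hX1⟩
  have hDenpos : (0 : ℝ) < Nat.card {d : ℤ | Squarefree d ∧ |d| ≤ (X : ℤ)} := by
    exact_mod_cast natCard_squarefree_abs_le_pos hX1
  rw [le_div_iff₀ hDenpos] at h2
  calc c * c₁ * (Nat.card {d : ℤ | Squarefree d ∧ |d| ≤ (X : ℤ)} : ℝ)
      = c * (c₁ * (Nat.card {d : ℤ | Squarefree d ∧ |d| ≤ (X : ℤ)} : ℝ)) := by ring
    _ ≤ c * (Nat.card {d : ℤ | Squarefree d ∧ |d| ≤ (X : ℤ) ∧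
          ∃ (K : Type) (_ : Field K) (_ : NumberField K), IsImaginaryQuadratic K ∧
            NumberField.discr K = d ∧ 4 < d.natAbs ∧ SatisfiesHeegnerHypothesis N K} : ℝ) :=
        mul_le_mul_of_nonneg_left h2 hc.le
    _ ≤ _ := h1

/-! ### The level-`1` instance -/

/-- **Every instance of the stub implies its level-`1` instance**: if C⁺(N,p) holds for some `N`, then the
squarefree `d` that are discriminants of imaginary quadratic fields with `|d| > 4` and `p ∤ h` (no splitting
condition: the Heegner hypothesis at level `1` is empty, `satisfiesHeegnerHypothesis_one`) are not a
`twistDensity`-null set — the local-condition-free Cohen–Lenstra-type non-vanishing density, open in print for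
`p ≥ 5`. [folklore] -/
theorem nonNull_one_of_nonNull {N : ℕ} (p : ℕ)
    (h : ¬ twistDensity (fun d : ℤ ↦ ∃ (K : Type) (_ : Field K) (_ : NumberField K),
        IsImaginaryQuadratic K ∧ NumberField.discr K = d ∧ 4 < d.natAbs ∧
        SatisfiesHeegnerHypothesis N K ∧ ¬ p ∣ NumberField.classNumber K) 0) :
    ¬ twistDensity (fun d : ℤ ↦ ∃ (K : Type) (_ : Field K) (_ : NumberField K),
        IsImaginaryQuadratic K ∧ NumberField.discr K = d ∧ 4 < d.natAbs ∧
        ¬ p ∣ NumberField.classNumber K) 0 :=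
  fun h1 => nonNull_of_dvd (one_dvd N) p h ((twistDensity_congr (fun _ _ =>
    ⟨fun ⟨K, iF, iN, hK, hd, h4, hcl⟩ => ⟨K, iF, iN, hK, hd, h4, satisfiesHeegnerHypothesis_one K, hcl⟩,
      fun ⟨K, iF, iN, hK, hd, h4, _, hcl⟩ => ⟨K, iF, iN, hK, hd, h4, hcl⟩⟩) 0).1 h1)

/-- **The registered stub, restated level-free**: `stub_nonNullIndivisibleHeegner` (all `N ≠ 0`, all primes
`p ≥ 5`) implies, for every prime `p ≥ 5`, that the discriminants `d` of imaginary quadratic fields with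
`|d| > 4` and `p ∤ h` are not `twistDensity`-null (its `N = 1` instance). [folklore] -/
theorem nonNull_one_of_stub
    (hstub : ∀ (N p : ℕ), N ≠ 0 → p.Prime → 5 ≤ p → ¬ twistDensity (fun d : ℤ ↦ ∃ (K : Type) (_ : Field K)
      (_ : NumberField K), IsImaginaryQuadratic K ∧ NumberField.discr K = d ∧ 4 < d.natAbs ∧
      SatisfiesHeegnerHypothesis N K ∧ ¬ p ∣ NumberField.classNumber K) 0)
    {p : ℕ} (hp : p.Prime) (h5 : 5 ≤ p) :
    ¬ twistDensity (fun d : ℤ ↦ ∃ (K : Type) (_ : Field K) (_ : NumberField K),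
        IsImaginaryQuadratic K ∧ NumberField.discr K = d ∧ 4 < d.natAbs ∧
        ¬ p ∣ NumberField.classNumber K) 0 :=
  nonNull_one_of_nonNull p (hstub 1 p one_ne_zero hp h5)

end Summit.BirchSwinnertonDyer.BirchSwinnertonDyer.Theorems.BiquadraticEisensteinDescentHeegnerTwistCouplingInSupplyHeegnerBoxDensityIff

end
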